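/-
Copyright (c) 2026 the pub-hodgecm-mathlib formalisation cell (harness21).  Prover seat hodgecm-mathlib-K2E3-p14 (g4) (free E3 hand on the E1 campaign
«EIS-RANK-ONE», deal [D2] (d₃-b) of K2E1-plan (g3) 2026-09-04T05:38:45Z), h413 = `stmt-HodgeConjecture-24833`, rung R6d₃ part (b): on `U(J₃) = U(2,1)` the
dilation bound `‖E(f)(g) − E(f)_B(g)‖ ≤ μ_F(D_F)⁻¹‖m‖|λ₂|⁻¹ Σ_{x₀} Σ_{η≠0}‖𝓕_F Φ_k(λ₁(x₀−Y),·)(ηλ₂⁻¹)‖ + μ_E(D_E)⁻¹‖m‖|λ₂|⁻¹|λ₁|⁻¹ Σ_{ξ≠0}‖𝓕_E Φ^Z_k(ξλ₁⁻¹)‖`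
and its power-law forms, hypothesis-first.  2026-09-04.
-/
import Summits.HodgeConjecture.HodgeConjecture.Theorems.K2E1EisensteinMinusConstantTermPoissonU3   -- ★ p857586 (this seat): part (a) at `N = 3` (two Poisson layers)
import Summits.HodgeConjecture.HodgeConjecture.Theorems.K2E1EisensteinMinusConstantTermBoundU2     -- ★ p857572 (K2E1-p02 (g5)): §1 `norm_adeleFourierCoeff_dilate` & co. (any number field)
import HarnessLib

/-!
# h413 ∕ Track B «K2-LIT», «EIS-RANK-ONE» R6d₃ (b) — helper `K2E1EisensteinMinusConstantTermBoundU3`: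
# the dilation bound for `E(f) − E(f)_B` on `U(J₃)` (two Poisson layers) and its power-law forms

Cell `pub/hodgecm-mathlib`, crux H413 = `stmt-HodgeConjecture-24833`, route `HCCMUnconditional`; DEAL [D2] (d₃-b) of the dealer K2E1-plan (g3) 2026-09-04T05:35:14Z ∕
05:38:45Z (the `N = 3` twin of ★ p857572 `K2E1EisensteinMinusConstantTermBoundU2` over ★ p857586 `K2E1EisensteinMinusConstantTermPoissonU3`).  THEOREMS ONLY (no `def`,
no `instance`, no `notation`, no named-fact hypothesis, no `sorry`); lane `--kind proof --supports stmt-HodgeConjecture-24833 --as helper` (count-neutral).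

THE MECHANISM (Garrett (2018) §2.9 at rank one; Mœglin–Waldspurger II.1.7).  Along `g = u·t·k` (`u = heis(X_u, t_u) ∈ N(𝔸)`, `t` in the maximal torus, `k ∈ K`)
the big-cell function of part (a) DILATES ON THE HEISENBERG GROUP: `Φ_g(X, t) = m · Φ_k(λ₁(X − Y), λ₂(t − y(X)))` with `λ₁ ∈ 𝕀_E`, `λ₂ ∈ 𝕀_F` the two root
dilations of `Ad(t⁻¹)` on `N∕Z ≅ 𝔸_E` and `Z ≅ 𝔸_F`, `Y = −X_u`, an `X`-dependent central translation `y(X)` (the Heisenberg cross term), and the section-law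
multiplier `m` at `w₀ t w₀⁻¹` — the STRUCTURE HYPOTHESIS `hdil` of this file (its derivation from the group law is the sequel (d₃-b-i)
`K2E1BigCellHeisenbergDilationU3`).  Consequences: (i) the centre average dilates on `𝔸_E`: `Φ^Z_g(X) = m|λ₂|⁻¹ · Φ^Z_k(λ₁(X − Y))` (**`centreAverage_dilate`**, Haar
module `|λ₂|`); (ii) by Tate's Lemma 4.1.2 (★ `norm_adeleFourierCoeff_dilate`, both layers) the two Poisson tails of part (a) scale:
`‖E − E_B‖(g) ≤ μ_F(D_F)⁻¹·‖m‖|λ₂|⁻¹·Σ_{x₀∈E} Σ_{η≠0} ‖𝓕_F[Φ_k(λ₁(x₀ − Y), ·)](ηλ₂⁻¹)‖ + μ_E(D_E)⁻¹·‖m‖|λ₂|⁻¹|λ₁|_E⁻¹·Σ_{ξ≠0} ‖𝓕_E[Φ^Z_k](ξλ₁⁻¹)‖`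
(**`norm_sub_borelConstantTerm_le_of_dilation_three`**); (iii) with the two FOURIER-SIDE DECAY BINDERS — `hdecF` for the `x₀`-summed centre-line layer (discharged downstream by
★ p857643 (E2) over `F` per `x₀` and an adelic lattice count over `E`) and `hdecE` for the `E`-layer (★ (E2) over `E` verbatim) — the power-law forms
**`norm_sub_borelConstantTerm_le_of_decay_three`**, **`…_le_rpow_three`** (`‖m‖ = L^σ`, `|λ₁|_E = |λ₂|_F = L`) and the uniform cusp bound **`…_le_const_three`** (`L ≤ 1`).

HONEST LABEL.  Count-neutral helper; proves no printed statement; HC_CM is proved only modulo the 7 printed citations (2 remaining named inputs: hLiu418 =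
`stmt-HodgeConjecture-24832`, h413 = `stmt-HodgeConjecture-24833`) until rung 0 closes.

## References
* [Garrett2018] P. Garrett, *Modern Analysis of Automorphic Forms by Example*, vol. 1 (2018), §2.9.
* [MoeglinWaldspurger1995] C. Mœglin, J.-L. Waldspurger, *Spectral Decomposition and Eisenstein Series* (1995), I.2.12, II.1.7.
* [CasselsFrohlichANT1967] J. W. S. Cassels, A. Fröhlich (eds.), *Algebraic Number Theory* (1967), Ch. XV (Tate) Lemma 4.1.2.
-/

set_option autoImplicit false
set_option linter.dupNamespace false  -- the mandated namespace repeats the summit's segment (`HodgeConjecture.HodgeConjecture`)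

noncomputable section

open scoped Matrix NNReal
open MeasureTheory NumberField IsDedekindDomain MulAction
open Literature.NumberTheory.Automorphic Literature.NumberTheory.Automorphic.UnitaryGroup
open Summit.HodgeConjecture.HodgeConjecture.Cruxes.H413.K2E1BorelEisensteinU
open Summit.HodgeConjecture.HodgeConjecture.Cruxes.H413.K2E1EisensteinMinusConstantTermPoissonU2
open Summit.HodgeConjecture.HodgeConjecture.Cruxes.H413.K2E1EisensteinMinusConstantTermPoissonU3
open Summit.HodgeConjecture.HodgeConjecture.Cruxes.H413.K2E1EisensteinMinusConstantTermBoundU2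

namespace Summit.HodgeConjecture.HodgeConjecture.Cruxes.H413.K2E1EisensteinMinusConstantTermBoundU3

/-! ## §1 The Haar module of an adelic dilation-translation (any number field) -/

section Module

variable (K : Type) [Field K] [NumberField K] [MeasurableSpace (AdeleRing (𝓞 K) K)] [BorelSpace (AdeleRing (𝓞 K) K)]
  (μ : Measure (AdeleRing (𝓞 K) K)) [μ.IsAddHaarMeasure]

/-- **`∫ φ(λ(u − y)) du = |λ|⁻¹ ∫ φ`** on `𝔸_K` (translation invariance, then the module `d(λ⁻¹v) = |λ|⁻¹ dv` ★ `AdeleRing.distribHaarChar_eq_ideleNorm`).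
[cite: CasselsFrohlichANT1967, Ch. XV Lemma 4.1.2] -/
theorem integral_comp_mul_sub (φ : AdeleRing (𝓞 K) K → ℂ) (lam : (AdeleRing (𝓞 K) K)ˣ) (y : AdeleRing (𝓞 K) K) :
    ∫ u, φ ((lam : AdeleRing (𝓞 K) K) * (u - y)) ∂μ = ((((IdeleClassGroup.ideleNorm K lam : ℝ≥0) : ℝ)⁻¹ : ℝ) : ℂ) * ∫ v, φ v ∂μ := by
  haveI : LocallyCompactSpace (AdeleRing (𝓞 K) K) := locallyCompactSpace_adeleRing' K
  haveI : SecondCountableTopology (AdeleRing (𝓞 K) K) := secondCountableTopology_adeleRing K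
  haveI : μ.Regular := by infer_instance
  rw [← integral_add_right_eq_self _ y]
  simp_rw [add_sub_cancel_right]
  have h2 : ∀ w : AdeleRing (𝓞 K) K, φ ((lam : AdeleRing (𝓞 K) K) * w) = (fun v => φ v) (lam • w) := fun w => by
    simp only [Units.smul_def, smul_eq_mul]
  simp_rw [h2]
  have h3 := integral_comp_smul_eq_distribHaarChar_inv_smul μ lam (fun v : AdeleRing (𝓞 K) K => φ v)
  beta_reduce at h3
  rw [h3, map_inv, AdeleRing.distribHaarChar_eq_ideleNorm K lam, NNReal.coe_inv, Complex.real_smul]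

end Module

/-! ## §2 `U(J₃)`: the dilation bound and its power-law forms -/

section Heisenberg

variable {F E : Type} [Field F] [NumberField F] [Field E] [NumberField E] [Algebra F E] [Algebra.IsQuadraticExtension F E] {c : E ≃ₐ[F] E}
  {δ : E}

/-- **THE DILATION BOUND ON `U(J₃)`**: under the hypotheses of part (a) (★ `norm_eisensteinSeriesU_sub_borelConstantTerm_le_three`, with the three Fourier-side
summabilities now DERIVED from the dilation) and the STRUCTURE `hdil : Φ_g(X,t) = m · Φ_k(λ₁(X − Y), λ₂(t − y X))`:
`‖E − E_B‖(g) ≤ μ_F(D_F)⁻¹·‖m‖|λ₂|⁻¹·Σ_{x₀} Σ_{η≠0} ‖𝓕_F[Φ_k(λ₁(x₀ − Y),·)](ηλ₂⁻¹)‖ + μ_E(D_E)⁻¹·‖m‖|λ₂|⁻¹|λ₁|⁻¹·Σ_{ξ≠0} ‖𝓕_E[Φ^Z_k](ξλ₁⁻¹)‖`.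
[cite: Garrett2018, §2.9] [cite: MoeglinWaldspurger1995, II.1.7] -/
theorem norm_sub_borelConstantTerm_le_of_dilation_three (hc : c * c = 1) (hcδ : c δ = -δ) (hδ : δ ≠ 0)
    [MeasurableSpace (quasiSplit F E c 3).Adelic] [BorelSpace (quasiSplit F E c 3).Adelic]
    (νN : Measure ↥(adelicUnipotent F E c 3)) [νN.IsMulLeftInvariant] [νN.IsInvInvariant]
    {f : (quasiSplit F E c 3).Adelic → ℂ} (hfm : Measurable f)
    (hfN : ∀ (n : ↥(adelicUnipotent F E c 3)) (y : (quasiSplit F E c 3).Adelic), f ((n : (quasiSplit F E c 3).Adelic) * y) = f y)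
    (hfB : ∀ b ∈ borelU (c : E →+* E) ((StdForm.antidiagonal 3).over E), ∀ x : (quasiSplit F E c 3).Adelic, f ((quasiSplit F E c 3).toAdelic b * x) = f x)
    {𝓕 : Set ↥(adelicUnipotent F E c 3)} (h𝓕 : IsFundamentalDomain ↥(rationalUnipotent F E c 3) 𝓕 νN) (h𝓕₀ : νN 𝓕 ≠ 0) (h𝓕top : νN 𝓕 ≠ ⊤)
    (g : (quasiSplit F E c 3).Adelic)
    (hfin : ∫⁻ u in 𝓕, (∑' q : (quasiSplit F E c 3).quotientSubgroup ⧸ (borelAdelic F E c 3).subgroupOf (quasiSplit F E c 3).quotientSubgroup,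
        ‖f ((((q.out : (quasiSplit F E c 3).quotientSubgroup) : (quasiSplit F E c 3).Adelic))⁻¹ * (u : (quasiSplit F E c 3).Adelic) * g)‖ₑ) ∂νN < ⊤)
    (hs : Summable fun q : Quotient (orbitRel ↥(borelU (c : E →+* E) ((StdForm.antidiagonal 3).over E)) ↥(unitaryGroupOfForm (c : E →+* E) ((StdForm.antidiagonal 3).over E))) =>
      f ((quasiSplit F E c 3).toAdelic (Quotient.out q : ↥(unitaryGroupOfForm (c : E →+* E) ((StdForm.antidiagonal 3).over E))) * g))
    [MeasurableSpace (AdeleRing (𝓞 F) F)] [BorelSpace (AdeleRing (𝓞 F) F)] (μF : Measure (AdeleRing (𝓞 F) F)) [μF.IsAddHaarMeasure]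
    [MeasurableSpace (AdeleRing (𝓞 E) E)] [BorelSpace (AdeleRing (𝓞 E) E)] (μE : Measure (AdeleRing (𝓞 E) E)) [μE.IsAddHaarMeasure]
    {Φ : AdeleRing (𝓞 E) E → AdeleRing (𝓞 F) F → ℂ}
    (hΦ : ∀ X t, Φ X t = f (((quasiSplit F E c 3).toAdelic (weylLongU (c : E →+* E) (rfl : ((StdForm.antidiagonal 3).over E) = ((StdForm.antidiagonal 3).over E)))) *
      ((heisChart hc (X, traceZeroLine F E c hcδ hδ t) : ↥(adelicUnipotent F E c 3)) : (quasiSplit F E c 3).Adelic) * g))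
    (hsumN : Summable fun p : E × F => ‖Φ (algebraMap E (AdeleRing (𝓞 E) E) p.1) (algebraMap F (AdeleRing (𝓞 F) F) p.2)‖)
    (hΦc : ∀ x₀ : E, Continuous (Φ (algebraMap E (AdeleRing (𝓞 E) E) x₀)))
    (hΦi : ∀ x₀ : E, Integrable (Φ (algebraMap E (AdeleRing (𝓞 E) E) x₀)) μF)
    (hloc : ∀ x₀ : E, ∀ C : Set (AdeleRing (𝓞 F) F), IsCompact C → ∃ u : F → ℝ, Summable u ∧
      ∀ x ∈ C, ∀ ξ : F, ‖Φ (algebraMap E (AdeleRing (𝓞 E) E) x₀) (x + algebraMap F (AdeleRing (𝓞 F) F) ξ)‖ ≤ u ξ)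
    {ΦZ : AdeleRing (𝓞 E) E → ℂ} (hΦZ : ∀ X, ΦZ X = ((μF (adeleFundamentalDomain F)).toReal⁻¹ : ℂ) * ∫ t, Φ X t ∂μF)
    (hΦZc : Continuous ΦZ) (hΦZi : Integrable ΦZ μE)
    (hlocZ : ∀ C : Set (AdeleRing (𝓞 E) E), IsCompact C → ∃ u : E → ℝ, Summable u ∧
      ∀ x ∈ C, ∀ ξ : E, ‖ΦZ (x + algebraMap E (AdeleRing (𝓞 E) E) ξ)‖ ≤ u ξ)
    (hnorm : ((νN 𝓕).toReal⁻¹ : ℝ) • ∫ v : ↥(adelicUnipotent F E c 3), f (((quasiSplit F E c 3).toAdelic (weylLongU (c : E →+* E) (rfl : ((StdForm.antidiagonal 3).over E) = ((StdForm.antidiagonal 3).over E)))) * (v : (quasiSplit F E c 3).Adelic) * g) ∂νN =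
      ((μE (adeleFundamentalDomain E)).toReal⁻¹ : ℂ) * ∫ X, ΦZ X ∂μE)
    -- the DILATION STRUCTURE along `g = u·t·k` (sequel (d₃-b-i) `K2E1BigCellHeisenbergDilationU3`): `Φ_g(X,t) = m·Φ_k(λ₁(X − Y), λ₂(t − y(X)))`
    {Φk : AdeleRing (𝓞 E) E → AdeleRing (𝓞 F) F → ℂ} (m : ℂ) (lam₁ : (AdeleRing (𝓞 E) E)ˣ) (lam₂ : (AdeleRing (𝓞 F) F)ˣ) (Y : AdeleRing (𝓞 E) E) (y : AdeleRing (𝓞 E) E → AdeleRing (𝓞 F) F)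
    (hdil : ∀ X t, Φ X t = m * Φk ((lam₁ : AdeleRing (𝓞 E) E) * (X - Y)) ((lam₂ : AdeleRing (𝓞 F) F) * (t - y X)))
    {ΦZk : AdeleRing (𝓞 E) E → ℂ} (hΦZk : ∀ X, ΦZk X = ((μF (adeleFundamentalDomain F)).toReal⁻¹ : ℂ) * ∫ t, Φk X t ∂μF)
    -- summability of the DILATED Fourier sides
    (hsumkF : ∀ x₀ : E, Summable fun η : F =>
      ‖∫ v, Φk ((lam₁ : AdeleRing (𝓞 E) E) * (algebraMap E (AdeleRing (𝓞 E) E) x₀ - Y)) v * (adeleAddChar F (algebraMap F (AdeleRing (𝓞 F) F) η * ((lam₂⁻¹ : (AdeleRing (𝓞 F) F)ˣ) : AdeleRing (𝓞 F) F) * v) : ℂ) ∂μF‖)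
    (hsumkA : Summable fun x₀ : E => ∑' η : F, ({0}ᶜ : Set F).indicator (fun η =>
      ‖∫ v, Φk ((lam₁ : AdeleRing (𝓞 E) E) * (algebraMap E (AdeleRing (𝓞 E) E) x₀ - Y)) v * (adeleAddChar F (algebraMap F (AdeleRing (𝓞 F) F) η * ((lam₂⁻¹ : (AdeleRing (𝓞 F) F)ˣ) : AdeleRing (𝓞 F) F) * v) : ℂ) ∂μF‖) η)
    (hsumkE : Summable fun ξ : E =>
      ‖∫ V, ΦZk V * (adeleAddChar E (algebraMap E (AdeleRing (𝓞 E) E) ξ * ((lam₁⁻¹ : (AdeleRing (𝓞 E) E)ˣ) : AdeleRing (𝓞 E) E) * V) : ℂ) ∂μE‖) :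
    ‖eisensteinSeriesU f g - borelConstantTerm νN 𝓕 (eisensteinSeriesU f) g‖ ≤
      (μF (adeleFundamentalDomain F)).toReal⁻¹ * (‖m‖ * (((IdeleClassGroup.ideleNorm F lam₂ : ℝ≥0) : ℝ))⁻¹ *
        ∑' x₀ : E, ∑' η : F, ({0}ᶜ : Set F).indicator (fun η =>
          ‖∫ v, Φk ((lam₁ : AdeleRing (𝓞 E) E) * (algebraMap E (AdeleRing (𝓞 E) E) x₀ - Y)) v * (adeleAddChar F (algebraMap F (AdeleRing (𝓞 F) F) η * ((lam₂⁻¹ : (AdeleRing (𝓞 F) F)ˣ) : AdeleRing (𝓞 F) F) * v) : ℂ) ∂μF‖) η)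
      + (μE (adeleFundamentalDomain E)).toReal⁻¹ * (‖m‖ * (((IdeleClassGroup.ideleNorm F lam₂ : ℝ≥0) : ℝ))⁻¹ * (((IdeleClassGroup.ideleNorm E lam₁ : ℝ≥0) : ℝ))⁻¹ *
        ∑' ξ : E, ({0}ᶜ : Set E).indicator (fun ξ =>
          ‖∫ V, ΦZk V * (adeleAddChar E (algebraMap E (AdeleRing (𝓞 E) E) ξ * ((lam₁⁻¹ : (AdeleRing (𝓞 E) E)ˣ) : AdeleRing (𝓞 E) E) * V) : ℂ) ∂μE‖) ξ) := by
  -- (1) the centre-line layer dilates, per `x₀ ∈ E`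
  have hdilx : ∀ (x₀ : E) (t : AdeleRing (𝓞 F) F), Φ (algebraMap E (AdeleRing (𝓞 E) E) x₀) t =
      m * (fun v => Φk ((lam₁ : AdeleRing (𝓞 E) E) * (algebraMap E (AdeleRing (𝓞 E) E) x₀ - Y)) v) ((lam₂ : AdeleRing (𝓞 F) F) * (t - y (algebraMap E (AdeleRing (𝓞 E) E) x₀))) :=
    fun x₀ t => hdil _ t
  have hsumF : ∀ x₀ : E, Summable fun η : F => ‖adeleFourierCoeff μF (Φ (algebraMap E (AdeleRing (𝓞 E) E) x₀)) η‖ :=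
    fun x₀ => summable_norm_adeleFourierCoeff_dilate F μF m lam₂ _ (hdilx x₀) (hsumkF x₀)
  have hinner : ∀ x₀ : E, ∑' η : F, ({0}ᶜ : Set F).indicator (fun η => ‖adeleFourierCoeff μF (Φ (algebraMap E (AdeleRing (𝓞 E) E) x₀)) η‖) η =
      ‖m‖ * (((IdeleClassGroup.ideleNorm F lam₂ : ℝ≥0) : ℝ))⁻¹ * ∑' η : F, ({0}ᶜ : Set F).indicator (fun η =>
        ‖∫ v, Φk ((lam₁ : AdeleRing (𝓞 E) E) * (algebraMap E (AdeleRing (𝓞 E) E) x₀ - Y)) v * (adeleAddChar F (algebraMap F (AdeleRing (𝓞 F) F) η * ((lam₂⁻¹ : (AdeleRing (𝓞 F) F)ˣ) : AdeleRing (𝓞 F) F) * v) : ℂ) ∂μF‖) η :=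
    fun x₀ => tsum_indicator_norm_adeleFourierCoeff_dilate F μF m lam₂ _ (hdilx x₀)
  have hsumA : Summable fun x₀ : E => ∑' η : F, ({0}ᶜ : Set F).indicator (fun η => ‖adeleFourierCoeff μF (Φ (algebraMap E (AdeleRing (𝓞 E) E) x₀)) η‖) η := by
    simp_rw [hinner]; exact hsumkA.mul_left _
  -- (2) the centre average dilates on `𝔸_E`: `Φ^Z(X) = m|λ₂|⁻¹ · Φ^Z_k(λ₁(X − Y))`
  have hdilZ : ∀ X : AdeleRing (𝓞 E) E, ΦZ X = (m * ((((IdeleClassGroup.ideleNorm F lam₂ : ℝ≥0) : ℝ)⁻¹ : ℝ) : ℂ)) * ΦZk ((lam₁ : AdeleRing (𝓞 E) E) * (X - Y)) := by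
    intro X
    rw [hΦZ, hΦZk]
    simp_rw [hdil X]
    rw [integral_const_mul, integral_comp_mul_sub F μF (Φk ((lam₁ : AdeleRing (𝓞 E) E) * (X - Y))) lam₂ (y X)]
    ring
  have hsumE : Summable fun ξ : E => ‖adeleFourierCoeff μE ΦZ ξ‖ := summable_norm_adeleFourierCoeff_dilate E μE _ lam₁ Y hdilZ hsumkE
  have houter := tsum_indicator_norm_adeleFourierCoeff_dilate E μE _ lam₁ Y hdilZ
  -- (3) part (a) and the two scalings
  have h := norm_eisensteinSeriesU_sub_borelConstantTerm_le_three hc hcδ hδ νN hfm hfN hfB h𝓕 h𝓕₀ h𝓕top g hfin hs μF μE hΦ hsumN hΦc hΦi hloc hsumF hΦZ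
    hΦZc hΦZi hlocZ hsumE hsumA hnorm
  have hnm : ‖m * ((((IdeleClassGroup.ideleNorm F lam₂ : ℝ≥0) : ℝ)⁻¹ : ℝ) : ℂ)‖ = ‖m‖ * (((IdeleClassGroup.ideleNorm F lam₂ : ℝ≥0) : ℝ))⁻¹ := by
    rw [norm_mul, Complex.norm_real, Real.norm_of_nonneg (inv_nonneg.2 (NNReal.coe_nonneg _))]
  rw [tsum_congr hinner, tsum_mul_left, houter, hnm] at h
  exact h

/-- **… WITH THE TWO FOURIER-SIDE DECAY BINDERS**: if the `x₀`-summed centre-line tail is `≤ W·(|λ₂|⁻¹)^{−β_F}` (`hdecF`; downstream: ★ (E2) over `F` per `x₀` and an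
adelic lattice count over `E` produce `W`) and the `E`-layer tail is `≤ C_E·(|λ₁|_E⁻¹)^{−β_E}` (`hdecE`; ★ (E2) over `E` verbatim), then
`‖E − E_B‖(g) ≤ μ_F(D_F)⁻¹·W·‖m‖·|λ₂|^{β_F − 1} + μ_E(D_E)⁻¹·C_E·‖m‖·|λ₂|⁻¹·|λ₁|_E^{β_E − 1}`. [cite: Garrett2018, §2.9] [cite: MoeglinWaldspurger1995, II.1.7] -/
theorem norm_sub_borelConstantTerm_le_of_decay_three (hc : c * c = 1) (hcδ : c δ = -δ) (hδ : δ ≠ 0)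
    [MeasurableSpace (quasiSplit F E c 3).Adelic] [BorelSpace (quasiSplit F E c 3).Adelic]
    (νN : Measure ↥(adelicUnipotent F E c 3)) [νN.IsMulLeftInvariant] [νN.IsInvInvariant]
    {f : (quasiSplit F E c 3).Adelic → ℂ} (hfm : Measurable f)
    (hfN : ∀ (n : ↥(adelicUnipotent F E c 3)) (y : (quasiSplit F E c 3).Adelic), f ((n : (quasiSplit F E c 3).Adelic) * y) = f y)
    (hfB : ∀ b ∈ borelU (c : E →+* E) ((StdForm.antidiagonal 3).over E), ∀ x : (quasiSplit F E c 3).Adelic, f ((quasiSplit F E c 3).toAdelic b * x) = f x)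
    {𝓕 : Set ↥(adelicUnipotent F E c 3)} (h𝓕 : IsFundamentalDomain ↥(rationalUnipotent F E c 3) 𝓕 νN) (h𝓕₀ : νN 𝓕 ≠ 0) (h𝓕top : νN 𝓕 ≠ ⊤)
    (g : (quasiSplit F E c 3).Adelic)
    (hfin : ∫⁻ u in 𝓕, (∑' q : (quasiSplit F E c 3).quotientSubgroup ⧸ (borelAdelic F E c 3).subgroupOf (quasiSplit F E c 3).quotientSubgroup,
        ‖f ((((q.out : (quasiSplit F E c 3).quotientSubgroup) : (quasiSplit F E c 3).Adelic))⁻¹ * (u : (quasiSplit F E c 3).Adelic) * g)‖ₑ) ∂νN < ⊤)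
    (hs : Summable fun q : Quotient (orbitRel ↥(borelU (c : E →+* E) ((StdForm.antidiagonal 3).over E)) ↥(unitaryGroupOfForm (c : E →+* E) ((StdForm.antidiagonal 3).over E))) =>
      f ((quasiSplit F E c 3).toAdelic (Quotient.out q : ↥(unitaryGroupOfForm (c : E →+* E) ((StdForm.antidiagonal 3).over E))) * g))
    [MeasurableSpace (AdeleRing (𝓞 F) F)] [BorelSpace (AdeleRing (𝓞 F) F)] (μF : Measure (AdeleRing (𝓞 F) F)) [μF.IsAddHaarMeasure]
    [MeasurableSpace (AdeleRing (𝓞 E) E)] [BorelSpace (AdeleRing (𝓞 E) E)] (μE : Measure (AdeleRing (𝓞 E) E)) [μE.IsAddHaarMeasure]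
    {Φ : AdeleRing (𝓞 E) E → AdeleRing (𝓞 F) F → ℂ}
    (hΦ : ∀ X t, Φ X t = f (((quasiSplit F E c 3).toAdelic (weylLongU (c : E →+* E) (rfl : ((StdForm.antidiagonal 3).over E) = ((StdForm.antidiagonal 3).over E)))) *
      ((heisChart hc (X, traceZeroLine F E c hcδ hδ t) : ↥(adelicUnipotent F E c 3)) : (quasiSplit F E c 3).Adelic) * g))
    (hsumN : Summable fun p : E × F => ‖Φ (algebraMap E (AdeleRing (𝓞 E) E) p.1) (algebraMap F (AdeleRing (𝓞 F) F) p.2)‖)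
    (hΦc : ∀ x₀ : E, Continuous (Φ (algebraMap E (AdeleRing (𝓞 E) E) x₀)))
    (hΦi : ∀ x₀ : E, Integrable (Φ (algebraMap E (AdeleRing (𝓞 E) E) x₀)) μF)
    (hloc : ∀ x₀ : E, ∀ C : Set (AdeleRing (𝓞 F) F), IsCompact C → ∃ u : F → ℝ, Summable u ∧
      ∀ x ∈ C, ∀ ξ : F, ‖Φ (algebraMap E (AdeleRing (𝓞 E) E) x₀) (x + algebraMap F (AdeleRing (𝓞 F) F) ξ)‖ ≤ u ξ)
    {ΦZ : AdeleRing (𝓞 E) E → ℂ} (hΦZ : ∀ X, ΦZ X = ((μF (adeleFundamentalDomain F)).toReal⁻¹ : ℂ) * ∫ t, Φ X t ∂μF)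
    (hΦZc : Continuous ΦZ) (hΦZi : Integrable ΦZ μE)
    (hlocZ : ∀ C : Set (AdeleRing (𝓞 E) E), IsCompact C → ∃ u : E → ℝ, Summable u ∧
      ∀ x ∈ C, ∀ ξ : E, ‖ΦZ (x + algebraMap E (AdeleRing (𝓞 E) E) ξ)‖ ≤ u ξ)
    (hnorm : ((νN 𝓕).toReal⁻¹ : ℝ) • ∫ v : ↥(adelicUnipotent F E c 3), f (((quasiSplit F E c 3).toAdelic (weylLongU (c : E →+* E) (rfl : ((StdForm.antidiagonal 3).over E) = ((StdForm.antidiagonal 3).over E)))) * (v : (quasiSplit F E c 3).Adelic) * g) ∂νN =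
      ((μE (adeleFundamentalDomain E)).toReal⁻¹ : ℂ) * ∫ X, ΦZ X ∂μE)
    -- the DILATION STRUCTURE along `g = u·t·k` (sequel (d₃-b-i) `K2E1BigCellHeisenbergDilationU3`): `Φ_g(X,t) = m·Φ_k(λ₁(X − Y), λ₂(t − y(X)))`
    {Φk : AdeleRing (𝓞 E) E → AdeleRing (𝓞 F) F → ℂ} (m : ℂ) (lam₁ : (AdeleRing (𝓞 E) E)ˣ) (lam₂ : (AdeleRing (𝓞 F) F)ˣ) (Y : AdeleRing (𝓞 E) E) (y : AdeleRing (𝓞 E) E → AdeleRing (𝓞 F) F)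
    (hdil : ∀ X t, Φ X t = m * Φk ((lam₁ : AdeleRing (𝓞 E) E) * (X - Y)) ((lam₂ : AdeleRing (𝓞 F) F) * (t - y X)))
    {ΦZk : AdeleRing (𝓞 E) E → ℂ} (hΦZk : ∀ X, ΦZk X = ((μF (adeleFundamentalDomain F)).toReal⁻¹ : ℂ) * ∫ t, Φk X t ∂μF)
    -- summability of the DILATED Fourier sides
    (hsumkF : ∀ x₀ : E, Summable fun η : F =>
      ‖∫ v, Φk ((lam₁ : AdeleRing (𝓞 E) E) * (algebraMap E (AdeleRing (𝓞 E) E) x₀ - Y)) v * (adeleAddChar F (algebraMap F (AdeleRing (𝓞 F) F) η * ((lam₂⁻¹ : (AdeleRing (𝓞 F) F)ˣ) : AdeleRing (𝓞 F) F) * v) : ℂ) ∂μF‖)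
    (hsumkA : Summable fun x₀ : E => ∑' η : F, ({0}ᶜ : Set F).indicator (fun η =>
      ‖∫ v, Φk ((lam₁ : AdeleRing (𝓞 E) E) * (algebraMap E (AdeleRing (𝓞 E) E) x₀ - Y)) v * (adeleAddChar F (algebraMap F (AdeleRing (𝓞 F) F) η * ((lam₂⁻¹ : (AdeleRing (𝓞 F) F)ˣ) : AdeleRing (𝓞 F) F) * v) : ℂ) ∂μF‖) η)
    (hsumkE : Summable fun ξ : E =>
      ‖∫ V, ΦZk V * (adeleAddChar E (algebraMap E (AdeleRing (𝓞 E) E) ξ * ((lam₁⁻¹ : (AdeleRing (𝓞 E) E)ˣ) : AdeleRing (𝓞 E) E) * V) : ℂ) ∂μE‖)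
    {W CE βF βE : ℝ}
    (hdecF : ∑' x₀ : E, ∑' η : F, ({0}ᶜ : Set F).indicator (fun η =>
          ‖∫ v, Φk ((lam₁ : AdeleRing (𝓞 E) E) * (algebraMap E (AdeleRing (𝓞 E) E) x₀ - Y)) v * (adeleAddChar F (algebraMap F (AdeleRing (𝓞 F) F) η * ((lam₂⁻¹ : (AdeleRing (𝓞 F) F)ˣ) : AdeleRing (𝓞 F) F) * v) : ℂ) ∂μF‖) η ≤
      W * ((((IdeleClassGroup.ideleNorm F lam₂ : ℝ≥0) : ℝ))⁻¹) ^ (-βF))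
    (hdecE : ∑' ξ : E, ({0}ᶜ : Set E).indicator (fun ξ =>
          ‖∫ V, ΦZk V * (adeleAddChar E (algebraMap E (AdeleRing (𝓞 E) E) ξ * ((lam₁⁻¹ : (AdeleRing (𝓞 E) E)ˣ) : AdeleRing (𝓞 E) E) * V) : ℂ) ∂μE‖) ξ ≤
      CE * ((((IdeleClassGroup.ideleNorm E lam₁ : ℝ≥0) : ℝ))⁻¹) ^ (-βE)) :
    ‖eisensteinSeriesU f g - borelConstantTerm νN 𝓕 (eisensteinSeriesU f) g‖ ≤
      (μF (adeleFundamentalDomain F)).toReal⁻¹ * W * ‖m‖ * (((IdeleClassGroup.ideleNorm F lam₂ : ℝ≥0) : ℝ)) ^ (βF - 1)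
      + (μE (adeleFundamentalDomain E)).toReal⁻¹ * CE * ‖m‖ * (((IdeleClassGroup.ideleNorm F lam₂ : ℝ≥0) : ℝ))⁻¹ * (((IdeleClassGroup.ideleNorm E lam₁ : ℝ≥0) : ℝ)) ^ (βE - 1) := by
  have h2 : 0 < (((IdeleClassGroup.ideleNorm F lam₂ : ℝ≥0) : ℝ)) := by exact_mod_cast pos_iff_ne_zero.2 (ideleNorm_ne_zero (K := F) lam₂)
  have h1 : 0 < (((IdeleClassGroup.ideleNorm E lam₁ : ℝ≥0) : ℝ)) := by exact_mod_cast pos_iff_ne_zero.2 (ideleNorm_ne_zero (K := E) lam₁)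
  refine (norm_sub_borelConstantTerm_le_of_dilation_three hc hcδ hδ νN hfm hfN hfB h𝓕 h𝓕₀ h𝓕top g hfin hs μF μE hΦ hsumN hΦc hΦi hloc hΦZ hΦZc hΦZi hlocZ hnorm m lam₁ lam₂ Y y hdil hΦZk hsumkF hsumkA hsumkE).trans ?_
  have hF : ‖m‖ * (((IdeleClassGroup.ideleNorm F lam₂ : ℝ≥0) : ℝ))⁻¹ * ∑' x₀ : E, ∑' η : F, ({0}ᶜ : Set F).indicator (fun η =>
          ‖∫ v, Φk ((lam₁ : AdeleRing (𝓞 E) E) * (algebraMap E (AdeleRing (𝓞 E) E) x₀ - Y)) v * (adeleAddChar F (algebraMap F (AdeleRing (𝓞 F) F) η * ((lam₂⁻¹ : (AdeleRing (𝓞 F) F)ˣ) : AdeleRing (𝓞 F) F) * v) : ℂ) ∂μF‖) η ≤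
      ‖m‖ * (((IdeleClassGroup.ideleNorm F lam₂ : ℝ≥0) : ℝ))⁻¹ * (W * ((((IdeleClassGroup.ideleNorm F lam₂ : ℝ≥0) : ℝ))⁻¹) ^ (-βF)) := mul_le_mul_of_nonneg_left hdecF (mul_nonneg (norm_nonneg _) (inv_nonneg.2 h2.le))
  have hE : ‖m‖ * (((IdeleClassGroup.ideleNorm F lam₂ : ℝ≥0) : ℝ))⁻¹ * (((IdeleClassGroup.ideleNorm E lam₁ : ℝ≥0) : ℝ))⁻¹ * ∑' ξ : E, ({0}ᶜ : Set E).indicator (fun ξ =>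
          ‖∫ V, ΦZk V * (adeleAddChar E (algebraMap E (AdeleRing (𝓞 E) E) ξ * ((lam₁⁻¹ : (AdeleRing (𝓞 E) E)ˣ) : AdeleRing (𝓞 E) E) * V) : ℂ) ∂μE‖) ξ ≤
      ‖m‖ * (((IdeleClassGroup.ideleNorm F lam₂ : ℝ≥0) : ℝ))⁻¹ * (((IdeleClassGroup.ideleNorm E lam₁ : ℝ≥0) : ℝ))⁻¹ * (CE * ((((IdeleClassGroup.ideleNorm E lam₁ : ℝ≥0) : ℝ))⁻¹) ^ (-βE)) :=
    mul_le_mul_of_nonneg_left hdecE (mul_nonneg (mul_nonneg (norm_nonneg _) (inv_nonneg.2 h2.le)) (inv_nonneg.2 h1.le))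
  refine (add_le_add (mul_le_mul_of_nonneg_left hF (inv_nonneg.2 ENNReal.toReal_nonneg)) (mul_le_mul_of_nonneg_left hE (inv_nonneg.2 ENNReal.toReal_nonneg))).trans
    (le_of_eq ?_)
  rw [Real.inv_rpow h2.le, Real.rpow_neg h2.le, inv_inv, Real.rpow_sub h2, Real.rpow_one, Real.inv_rpow h1.le, Real.rpow_neg h1.le, inv_inv, Real.rpow_sub h1,
    Real.rpow_one]
  field_simp

/-- **… THE UNIFORM BOUND IN THE CUSP (R6e's `∃ M` at `N = 3`)**: if moreover `‖m‖ = L^σ` with `L = |λ₂|_F = |λ₁|_E ≤ 1` (the section law and `H(g) ≥ H(k)`),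
the lattice-count constant `W ≤ B·(L⁻¹)^θ`, and the exponents satisfy `θ + 1 ≤ σ + β_F`, `2 ≤ σ + β_E`, then `‖E(f)(g) − E(f)_B(g)‖ ≤ μ_F(D_F)⁻¹·B + μ_E(D_E)⁻¹·C_E`
— independent of `g`; every hypothesis named. [cite: Garrett2018, §2.9] [cite: MoeglinWaldspurger1995, I.2.12] -/
theorem norm_sub_borelConstantTerm_le_const_three (hc : c * c = 1) (hcδ : c δ = -δ) (hδ : δ ≠ 0)
    [MeasurableSpace (quasiSplit F E c 3).Adelic] [BorelSpace (quasiSplit F E c 3).Adelic]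
    (νN : Measure ↥(adelicUnipotent F E c 3)) [νN.IsMulLeftInvariant] [νN.IsInvInvariant]
    {f : (quasiSplit F E c 3).Adelic → ℂ} (hfm : Measurable f)
    (hfN : ∀ (n : ↥(adelicUnipotent F E c 3)) (y : (quasiSplit F E c 3).Adelic), f ((n : (quasiSplit F E c 3).Adelic) * y) = f y)
    (hfB : ∀ b ∈ borelU (c : E →+* E) ((StdForm.antidiagonal 3).over E), ∀ x : (quasiSplit F E c 3).Adelic, f ((quasiSplit F E c 3).toAdelic b * x) = f x)
    {𝓕 : Set ↥(adelicUnipotent F E c 3)} (h𝓕 : IsFundamentalDomain ↥(rationalUnipotent F E c 3) 𝓕 νN) (h𝓕₀ : νN 𝓕 ≠ 0) (h𝓕top : νN 𝓕 ≠ ⊤)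
    (g : (quasiSplit F E c 3).Adelic)
    (hfin : ∫⁻ u in 𝓕, (∑' q : (quasiSplit F E c 3).quotientSubgroup ⧸ (borelAdelic F E c 3).subgroupOf (quasiSplit F E c 3).quotientSubgroup,
        ‖f ((((q.out : (quasiSplit F E c 3).quotientSubgroup) : (quasiSplit F E c 3).Adelic))⁻¹ * (u : (quasiSplit F E c 3).Adelic) * g)‖ₑ) ∂νN < ⊤)
    (hs : Summable fun q : Quotient (orbitRel ↥(borelU (c : E →+* E) ((StdForm.antidiagonal 3).over E)) ↥(unitaryGroupOfForm (c : E →+* E) ((StdForm.antidiagonal 3).over E))) =>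
      f ((quasiSplit F E c 3).toAdelic (Quotient.out q : ↥(unitaryGroupOfForm (c : E →+* E) ((StdForm.antidiagonal 3).over E))) * g))
    [MeasurableSpace (AdeleRing (𝓞 F) F)] [BorelSpace (AdeleRing (𝓞 F) F)] (μF : Measure (AdeleRing (𝓞 F) F)) [μF.IsAddHaarMeasure]
    [MeasurableSpace (AdeleRing (𝓞 E) E)] [BorelSpace (AdeleRing (𝓞 E) E)] (μE : Measure (AdeleRing (𝓞 E) E)) [μE.IsAddHaarMeasure]
    {Φ : AdeleRing (𝓞 E) E → AdeleRing (𝓞 F) F → ℂ}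
    (hΦ : ∀ X t, Φ X t = f (((quasiSplit F E c 3).toAdelic (weylLongU (c : E →+* E) (rfl : ((StdForm.antidiagonal 3).over E) = ((StdForm.antidiagonal 3).over E)))) *
      ((heisChart hc (X, traceZeroLine F E c hcδ hδ t) : ↥(adelicUnipotent F E c 3)) : (quasiSplit F E c 3).Adelic) * g))
    (hsumN : Summable fun p : E × F => ‖Φ (algebraMap E (AdeleRing (𝓞 E) E) p.1) (algebraMap F (AdeleRing (𝓞 F) F) p.2)‖)
    (hΦc : ∀ x₀ : E, Continuous (Φ (algebraMap E (AdeleRing (𝓞 E) E) x₀)))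
    (hΦi : ∀ x₀ : E, Integrable (Φ (algebraMap E (AdeleRing (𝓞 E) E) x₀)) μF)
    (hloc : ∀ x₀ : E, ∀ C : Set (AdeleRing (𝓞 F) F), IsCompact C → ∃ u : F → ℝ, Summable u ∧
      ∀ x ∈ C, ∀ ξ : F, ‖Φ (algebraMap E (AdeleRing (𝓞 E) E) x₀) (x + algebraMap F (AdeleRing (𝓞 F) F) ξ)‖ ≤ u ξ)
    {ΦZ : AdeleRing (𝓞 E) E → ℂ} (hΦZ : ∀ X, ΦZ X = ((μF (adeleFundamentalDomain F)).toReal⁻¹ : ℂ) * ∫ t, Φ X t ∂μF)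
    (hΦZc : Continuous ΦZ) (hΦZi : Integrable ΦZ μE)
    (hlocZ : ∀ C : Set (AdeleRing (𝓞 E) E), IsCompact C → ∃ u : E → ℝ, Summable u ∧
      ∀ x ∈ C, ∀ ξ : E, ‖ΦZ (x + algebraMap E (AdeleRing (𝓞 E) E) ξ)‖ ≤ u ξ)
    (hnorm : ((νN 𝓕).toReal⁻¹ : ℝ) • ∫ v : ↥(adelicUnipotent F E c 3), f (((quasiSplit F E c 3).toAdelic (weylLongU (c : E →+* E) (rfl : ((StdForm.antidiagonal 3).over E) = ((StdForm.antidiagonal 3).over E)))) * (v : (quasiSplit F E c 3).Adelic) * g) ∂νN =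
      ((μE (adeleFundamentalDomain E)).toReal⁻¹ : ℂ) * ∫ X, ΦZ X ∂μE)
    -- the DILATION STRUCTURE along `g = u·t·k` (sequel (d₃-b-i) `K2E1BigCellHeisenbergDilationU3`): `Φ_g(X,t) = m·Φ_k(λ₁(X − Y), λ₂(t − y(X)))`
    {Φk : AdeleRing (𝓞 E) E → AdeleRing (𝓞 F) F → ℂ} (m : ℂ) (lam₁ : (AdeleRing (𝓞 E) E)ˣ) (lam₂ : (AdeleRing (𝓞 F) F)ˣ) (Y : AdeleRing (𝓞 E) E) (y : AdeleRing (𝓞 E) E → AdeleRing (𝓞 F) F)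
    (hdil : ∀ X t, Φ X t = m * Φk ((lam₁ : AdeleRing (𝓞 E) E) * (X - Y)) ((lam₂ : AdeleRing (𝓞 F) F) * (t - y X)))
    {ΦZk : AdeleRing (𝓞 E) E → ℂ} (hΦZk : ∀ X, ΦZk X = ((μF (adeleFundamentalDomain F)).toReal⁻¹ : ℂ) * ∫ t, Φk X t ∂μF)
    -- summability of the DILATED Fourier sides
    (hsumkF : ∀ x₀ : E, Summable fun η : F =>
      ‖∫ v, Φk ((lam₁ : AdeleRing (𝓞 E) E) * (algebraMap E (AdeleRing (𝓞 E) E) x₀ - Y)) v * (adeleAddChar F (algebraMap F (AdeleRing (𝓞 F) F) η * ((lam₂⁻¹ : (AdeleRing (𝓞 F) F)ˣ) : AdeleRing (𝓞 F) F) * v) : ℂ) ∂μF‖)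
    (hsumkA : Summable fun x₀ : E => ∑' η : F, ({0}ᶜ : Set F).indicator (fun η =>
      ‖∫ v, Φk ((lam₁ : AdeleRing (𝓞 E) E) * (algebraMap E (AdeleRing (𝓞 E) E) x₀ - Y)) v * (adeleAddChar F (algebraMap F (AdeleRing (𝓞 F) F) η * ((lam₂⁻¹ : (AdeleRing (𝓞 F) F)ˣ) : AdeleRing (𝓞 F) F) * v) : ℂ) ∂μF‖) η)
    (hsumkE : Summable fun ξ : E =>
      ‖∫ V, ΦZk V * (adeleAddChar E (algebraMap E (AdeleRing (𝓞 E) E) ξ * ((lam₁⁻¹ : (AdeleRing (𝓞 E) E)ˣ) : AdeleRing (𝓞 E) E) * V) : ℂ) ∂μE‖)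
    {W CE βF βE B σ θ : ℝ} (hB : 0 ≤ B) (hCE : 0 ≤ CE)
    (hdecF : ∑' x₀ : E, ∑' η : F, ({0}ᶜ : Set F).indicator (fun η =>
          ‖∫ v, Φk ((lam₁ : AdeleRing (𝓞 E) E) * (algebraMap E (AdeleRing (𝓞 E) E) x₀ - Y)) v * (adeleAddChar F (algebraMap F (AdeleRing (𝓞 F) F) η * ((lam₂⁻¹ : (AdeleRing (𝓞 F) F)ˣ) : AdeleRing (𝓞 F) F) * v) : ℂ) ∂μF‖) η ≤
      W * ((((IdeleClassGroup.ideleNorm F lam₂ : ℝ≥0) : ℝ))⁻¹) ^ (-βF))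
    (hdecE : ∑' ξ : E, ({0}ᶜ : Set E).indicator (fun ξ =>
          ‖∫ V, ΦZk V * (adeleAddChar E (algebraMap E (AdeleRing (𝓞 E) E) ξ * ((lam₁⁻¹ : (AdeleRing (𝓞 E) E)ˣ) : AdeleRing (𝓞 E) E) * V) : ℂ) ∂μE‖) ξ ≤
      CE * ((((IdeleClassGroup.ideleNorm E lam₁ : ℝ≥0) : ℝ))⁻¹) ^ (-βE))
    (hm : ‖m‖ = (((IdeleClassGroup.ideleNorm F lam₂ : ℝ≥0) : ℝ)) ^ σ) (hL : (((IdeleClassGroup.ideleNorm E lam₁ : ℝ≥0) : ℝ)) = (((IdeleClassGroup.ideleNorm F lam₂ : ℝ≥0) : ℝ))) (hW : W ≤ B * ((((IdeleClassGroup.ideleNorm F lam₂ : ℝ≥0) : ℝ))⁻¹) ^ θ)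
    (hlam : (((IdeleClassGroup.ideleNorm F lam₂ : ℝ≥0) : ℝ)) ≤ 1) (hθ : θ + 1 ≤ σ + βF) (hσE : 2 ≤ σ + βE) :
    ‖eisensteinSeriesU f g - borelConstantTerm νN 𝓕 (eisensteinSeriesU f) g‖ ≤
      (μF (adeleFundamentalDomain F)).toReal⁻¹ * B + (μE (adeleFundamentalDomain E)).toReal⁻¹ * CE := by
  have h2 : 0 < (((IdeleClassGroup.ideleNorm F lam₂ : ℝ≥0) : ℝ)) := by exact_mod_cast pos_iff_ne_zero.2 (ideleNorm_ne_zero (K := F) lam₂)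
  have hμF : 0 ≤ (μF (adeleFundamentalDomain F)).toReal⁻¹ := inv_nonneg.2 ENNReal.toReal_nonneg
  have hμE : 0 ≤ (μE (adeleFundamentalDomain E)).toReal⁻¹ := inv_nonneg.2 ENNReal.toReal_nonneg
  refine (norm_sub_borelConstantTerm_le_of_decay_three hc hcδ hδ νN hfm hfN hfB h𝓕 h𝓕₀ h𝓕top g hfin hs μF μE hΦ hsumN hΦc hΦi hloc hΦZ hΦZc hΦZi hlocZ hnorm m lam₁ lam₂ Y y hdil hΦZk hsumkF hsumkA hsumkE hdecF hdecE).trans ?_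
  rw [hm, hL]
  -- first layer: `W · L^σ · L^{β_F−1} ≤ B · L^{σ+β_F−1−θ} ≤ B`
  have hσ0 : 0 ≤ (((IdeleClassGroup.ideleNorm F lam₂ : ℝ≥0) : ℝ)) ^ σ := Real.rpow_nonneg h2.le σ
  have hF : W * (((IdeleClassGroup.ideleNorm F lam₂ : ℝ≥0) : ℝ)) ^ σ * (((IdeleClassGroup.ideleNorm F lam₂ : ℝ≥0) : ℝ)) ^ (βF - 1) ≤ B := by
    have hW' : W * (((IdeleClassGroup.ideleNorm F lam₂ : ℝ≥0) : ℝ)) ^ σ * (((IdeleClassGroup.ideleNorm F lam₂ : ℝ≥0) : ℝ)) ^ (βF - 1) ≤ B * ((((IdeleClassGroup.ideleNorm F lam₂ : ℝ≥0) : ℝ))⁻¹) ^ θ * (((IdeleClassGroup.ideleNorm F lam₂ : ℝ≥0) : ℝ)) ^ σ * (((IdeleClassGroup.ideleNorm F lam₂ : ℝ≥0) : ℝ)) ^ (βF - 1) :=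
      mul_le_mul_of_nonneg_right (mul_le_mul_of_nonneg_right hW hσ0) (Real.rpow_nonneg h2.le _)
    refine hW'.trans ?_
    rw [Real.inv_rpow h2.le, ← Real.rpow_neg h2.le, mul_assoc, mul_assoc, ← Real.rpow_add h2, ← Real.rpow_add h2]
    refine (mul_le_mul_of_nonneg_left (Real.rpow_le_one h2.le hlam (by linarith)) hB).trans (le_of_eq (mul_one B))
  -- second layer: `C_E · L^σ · L⁻¹ · L^{β_E−1} = C_E · L^{σ+β_E−2} ≤ C_E`
  have hE : CE * (((IdeleClassGroup.ideleNorm F lam₂ : ℝ≥0) : ℝ)) ^ σ * (((IdeleClassGroup.ideleNorm F lam₂ : ℝ≥0) : ℝ))⁻¹ * (((IdeleClassGroup.ideleNorm F lam₂ : ℝ≥0) : ℝ)) ^ (βE - 1) ≤ CE := by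
    rw [← Real.rpow_neg_one, mul_assoc, mul_assoc, ← Real.rpow_add h2, ← Real.rpow_add h2]
    refine (mul_le_mul_of_nonneg_left (Real.rpow_le_one h2.le hlam (by linarith)) hCE).trans (le_of_eq (mul_one CE))
  calc (μF (adeleFundamentalDomain F)).toReal⁻¹ * W * (((IdeleClassGroup.ideleNorm F lam₂ : ℝ≥0) : ℝ)) ^ σ * (((IdeleClassGroup.ideleNorm F lam₂ : ℝ≥0) : ℝ)) ^ (βF - 1)
        + (μE (adeleFundamentalDomain E)).toReal⁻¹ * CE * (((IdeleClassGroup.ideleNorm F lam₂ : ℝ≥0) : ℝ)) ^ σ * (((IdeleClassGroup.ideleNorm F lam₂ : ℝ≥0) : ℝ))⁻¹ * (((IdeleClassGroup.ideleNorm F lam₂ : ℝ≥0) : ℝ)) ^ (βE - 1)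
      = (μF (adeleFundamentalDomain F)).toReal⁻¹ * (W * (((IdeleClassGroup.ideleNorm F lam₂ : ℝ≥0) : ℝ)) ^ σ * (((IdeleClassGroup.ideleNorm F lam₂ : ℝ≥0) : ℝ)) ^ (βF - 1))
        + (μE (adeleFundamentalDomain E)).toReal⁻¹ * (CE * (((IdeleClassGroup.ideleNorm F lam₂ : ℝ≥0) : ℝ)) ^ σ * (((IdeleClassGroup.ideleNorm F lam₂ : ℝ≥0) : ℝ))⁻¹ * (((IdeleClassGroup.ideleNorm F lam₂ : ℝ≥0) : ℝ)) ^ (βE - 1)) := by ring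
    _ ≤ (μF (adeleFundamentalDomain F)).toReal⁻¹ * B + (μE (adeleFundamentalDomain E)).toReal⁻¹ * CE :=
      add_le_add (mul_le_mul_of_nonneg_left hF hμF) (mul_le_mul_of_nonneg_left hE hμE)

end Heisenberg

end Summit.HodgeConjecture.HodgeConjecture.Cruxes.H413.K2E1EisensteinMinusConstantTermBoundU3

end
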